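import Literature.NumberTheory.EllipticCurves.HalfIntegralWeightFormsProofs
import Literature.NumberTheory.EllipticCurves.ModularCurveSturmProofs
import HarnessLib

/-!
# A Sturm bound for cusp forms of half-integral weight (through the eighth power)

Infrastructure for dimension counts in `S_{k/2}(N, χ)` (`halfIntCuspForms k N χ`, Shimura's
spaces as set up in `HalfIntegralWeightForms`), used for the Cohen–Oesterlé input of Tunnell's
Theorem 2 (`S_{3/2}(128, χ₂) = span {g θ₁, g θ₄, g θ₁₆}`, Tunnell 1983, p. 327). For
`f ∈ S_{k/2}(N, χ)` with `4 ∣ N` and `χ⁸ = 1`: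

* `pow_eight_smul` — `f(γz)⁸ = (cz + d)^{4k} f(z)⁸` for `γ ∈ Γ₀(N)`: the eighth power of the
  automorphy factor `χ(d) j(γ, z)^k` is `(cz + d)^{4k}` (`autFactor_pow_eight`, from
  `j(γ, z)² = χ₋₄(d)(cz + d)`, `thetaFactor_sq`);
* `powEightCuspForm` — **`f⁸` is a cusp form of (integral) weight `4k` for `Γ₀(N)`** in Mathlib's
  sense (`CuspForm (Gamma0 N) (4k)`), its translates being `(f⁸)|_{4k} g = (slashSq k f g)⁴`
  (`pow_eight_slash`);
* `eq_zero_of_lt_finsum_slashSq` — **the vanishing criterion**: if to every coset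
  `q ∈ SL₂(ℤ)/Γ₀(N)` a rate `δ_q` is attached such that `slashSq k f g = O(e^{-2π δ_q Im τ})`
  for some `g` with `q = g⁻¹ Γ₀(N)`, and `∑_q δ_q > k μ / 12` (`μ = [SL₂(ℤ) : Γ₀(N)]`; note
  `slashSq = (f|g)²`, so `δ_q` is twice the decay rate of `f` at the cusp `g∞`), then `f = 0` —
  the tree's decay-form Sturm bound `coe_eq_zero_of_lt_finsum` (`ModularCurveSturmProofs`)
  applied to `f⁸`, whose coset translates decay with the rates `4 δ_q` against the threshold
  `4k μ / 12`;
* `slashSq_isBigO_generic` — the rate every coset has for free: `slashSq k f g = O(e^{-2π Im τ/(2w)})`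
  where `w` is the width of the cusp `g∞` (any `w ≥ 1` with `g T^w g⁻¹ ∈ Γ₀(N)`), from the
  `q_w`-expansion of the integral-weight cusp form `f⁸`.

No statement of the tree is used unproved; no definitions of spaces or new named facts.

## References

* G. Shimura, *On modular forms of half integral weight*, Ann. of Math. 97 (1973) 440–481, §1
  (the cusp conditions through `f|[ξ]`, `ξ` over `SL₂(ℤ)`). [Shimura1973HalfIntegral]
* J. Sturm, *On the congruence of modular forms*, LNM 1240 (1987) 275–280, Thm. 1.
* H. Cohen, J. Oesterlé, *Dimensions des espaces de formes modulaires*, LNM 627 (1977) 69–78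
  (the dimension formula this infrastructure replaces in the instance `N = 128`, `k = 3`).
-/

noncomputable section

open UpperHalfPlane hiding I
open ModularForm SlashInvariantForm Complex Filter Asymptotics CongruenceSubgroup
open scoped MatrixGroups Topology Real Manifold ModularForm

namespace Literature.NumberTheory.EllipticCurves.ModularForms

variable {k N : ℕ} {χ : DirichletCharacter ℂ N}

/-! ### The eighth power of the automorphy factor -/

/-- `(χ(d) j(γ, z)^k)⁸ = χ(d)⁸ (cz + d)^{4k}`, from `j(γ, z)² = χ₋₄(d)(cz + d)`. [folklore] -/
theorem autFactor_pow_eight (γ : SL(2, ℤ)) (z : ℍ) :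
    autFactor k N χ γ z ^ 8 =
      χ ((γ 1 1 : ℤ) : ZMod N) ^ 8 * (((γ 1 0 : ℤ) : ℂ) * z + ((γ 1 1 : ℤ) : ℂ)) ^ (4 * k) := by
  unfold autFactor
  rw [mul_pow, ← pow_mul, show k * 8 = 2 * (4 * k) by ring, pow_mul,
    thetaFactor_sq (gcd_c_d_eq_one γ) z, mul_pow]
  have h1 : ((if (γ 1 1 : ℤ) % 4 = 3 then -1 else 1 : ℂ)) ^ (4 * k) = 1 := by
    split_ifs
    · rw [pow_mul]; norm_num
    · exact one_pow _
  rw [h1, one_mul]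

/-- For `χ⁸ = 1` and `γ ∈ Γ₀(N)`: `χ(d)⁸ = 1`. [folklore] -/
theorem chi_d_pow_eight (hχ : χ ^ 8 = 1) {γ : SL(2, ℤ)} (hγ : γ ∈ Gamma0 N) :
    χ ((γ 1 1 : ℤ) : ZMod N) ^ 8 = 1 := by
  rw [← MulChar.pow_apply' χ (by norm_num), hχ, MulChar.one_apply (isUnit_d_of_mem_Gamma0 hγ)]

/-- **`f(γz)⁸ = (cz + d)^{4k} f(z)⁸`** for `f ∈ M_{k/2}(N, χ)`, `4 ∣ N`, `χ⁸ = 1`, `γ ∈ Γ₀(N)`.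
[cite: Shimura1973HalfIntegral, §1] -/
theorem pow_eight_smul (hN : 4 ∣ N) (hχ : χ ^ 8 = 1) {f : ℍ → ℂ}
    (hf : f ∈ halfIntModularForms k N χ) {γ : SL(2, ℤ)} (hγ : γ ∈ Gamma0 N) (z : ℍ) :
    f (γ • z) ^ 8 = (((γ 1 0 : ℤ) : ℂ) * z + ((γ 1 1 : ℤ) : ℂ)) ^ (4 * k) * f z ^ 8 := by
  rw [apply_smul_eq_of_mem hN hf hγ z, mul_pow, autFactor_pow_eight, chi_d_pow_eight hχ hγ,
    one_mul]

/-! ### `f⁸` as an integral-weight cusp form -/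

/-- `(f⁸)|_{4k} g = (slashSq k f g)⁴` for every `g ∈ SL₂(ℤ)`. [folklore] -/
theorem pow_eight_slash (f : ℍ → ℂ) (g : SL(2, ℤ)) :
    (fun z : ℍ ↦ f z ^ 8) ∣[((4 * k : ℕ) : ℤ)] g = fun z ↦ slashSq k f g z ^ 4 := by
  funext z
  rw [SL_slash_apply, slashSq, div_pow, ← pow_mul, zpow_neg, zpow_natCast,
    div_eq_mul_inv, ← pow_mul, show k * 4 = 4 * k by ring]

/-- `(f⁸)|_{4k} γ = f⁸` for `γ ∈ Γ₀(N)` (`f ∈ M_{k/2}(N, χ)`, `4 ∣ N`, `χ⁸ = 1`). [folklore] -/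
theorem pow_eight_slash_of_mem (hN : 4 ∣ N) (hχ : χ ^ 8 = 1) {f : ℍ → ℂ}
    (hf : f ∈ halfIntModularForms k N χ) {γ : SL(2, ℤ)} (hγ : γ ∈ Gamma0 N) :
    (fun z : ℍ ↦ f z ^ 8) ∣[((4 * k : ℕ) : ℤ)] γ = fun z ↦ f z ^ 8 := by
  funext z
  rw [SL_slash_apply, pow_eight_smul hN hχ hf hγ z, ModularGroup.denom_apply, zpow_neg,
    zpow_natCast]
  have hne : ((γ 1 0 : ℤ) : ℂ) * z + ((γ 1 1 : ℤ) : ℂ) ≠ 0 := intLinear_ne_zero (gcd_c_d_eq_one γ) z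
  field_simp

/-- **`f⁸ ∈ S_{4k}(Γ₀(N))`** for `f ∈ S_{k/2}(N, χ)`, `4 ∣ N`, `χ⁸ = 1`: invariance by
`pow_eight_slash_of_mem`, holomorphy from that of `f`, vanishing at every cusp because
`(f⁸)|g = (slashSq k f g)⁴ → 0` at `i∞` for every `g ∈ SL₂(ℤ)` (the cusp condition of
`halfIntCuspForms`). [cite: Shimura1973HalfIntegral, §1] -/
def powEightCuspForm [NeZero N] (hN : 4 ∣ N) (hχ : χ ^ 8 = 1) {f : ℍ → ℂ}
    (hf : f ∈ halfIntCuspForms k N χ) : CuspForm (Gamma0 N) ((4 * k : ℕ) : ℤ) where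
  toFun := fun z ↦ f z ^ 8
  slash_action_eq' A hA := by
    obtain ⟨γ, hγ, rfl⟩ := hA
    exact pow_eight_slash_of_mem hN hχ (halfIntCuspForms_le_halfIntModularForms k N χ hf) hγ
  holo' := hf.1.pow 8
  zero_at_cusps' hc := by
    rw [Subgroup.IsArithmetic.isCusp_iff_isCusp_SL2Z] at hc
    rw [OnePoint.isZeroAt_iff_forall_SL2Z hc]
    intro γ _
    change IsZeroAtImInfty ((fun z : ℍ ↦ f z ^ 8) ∣[((4 * k : ℕ) : ℤ)] (γ : GL (Fin 2) ℝ))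
    rw [← SL_slash, pow_eight_slash]
    have h := hf.2.2 γ
    have h4 : IsZeroAtImInfty (fun z : ℍ ↦ slashSq k f γ z ^ 4) := by
      have := (h.mul h).mul (h.mul h)
      simp only [mul_zero] at this
      refine this.congr' (Eventually.of_forall fun z ↦ ?_)
      ring
    exact h4

/-- The underlying function of `powEightCuspForm` is `f⁸`. [folklore] -/
@[simp] theorem coe_powEightCuspForm [NeZero N] (hN : 4 ∣ N) (hχ : χ ^ 8 = 1) {f : ℍ → ℂ}
    (hf : f ∈ halfIntCuspForms k N χ) :
    (powEightCuspForm hN hχ hf : ℍ → ℂ) = fun z ↦ f z ^ 8 := rfl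

/-- `f⁸ = 0` forces `f = 0`. [folklore] -/
theorem eq_zero_of_pow_eight_eq_zero {f : ℍ → ℂ} (h : (fun z : ℍ ↦ f z ^ 8) = 0) : f = 0 := by
  funext z
  have := congrFun h z
  simp only [Pi.zero_apply, pow_eq_zero_iff, OfNat.ofNat_ne_zero, ne_eq, not_false_eq_true] at this
  exact this

/-! ### The vanishing criterion -/

/-- Decay of `slashSq k f g` with rate `δ` gives decay of `(f⁸)|g = (slashSq k f g)⁴` with rate
`4δ`. [folklore] -/
theorem pow_eight_slash_isBigO {f : ℍ → ℂ} {g : SL(2, ℤ)} {δ : ℝ}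
    (h : slashSq k f g =O[atImInfty] fun τ ↦ Real.exp (-2 * π * δ * τ.im)) :
    ((fun z : ℍ ↦ f z ^ 8) ∣[((4 * k : ℕ) : ℤ)] g) =O[atImInfty]
      fun τ ↦ Real.exp (-2 * π * (4 * δ) * τ.im) := by
  rw [pow_eight_slash]
  refine (h.pow 4).congr_right fun τ ↦ ?_
  rw [← Real.exp_nat_mul]
  congr 1
  push_cast
  ring

/-- **Sturm-type vanishing criterion for `S_{k/2}(N, χ)`** (`4 ∣ N`, `χ⁸ = 1`). Attach to every
coset `q ∈ SL₂(ℤ)/Γ₀(N)` a real number `δ_q` such that for some `g ∈ SL₂(ℤ)` with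
`q = g⁻¹ Γ₀(N)` one has `slashSq k f g = f(gz)²/(cz+d)^k = O(e^{-2π δ_q Im z})` at `i∞`. If
`∑_q 4 δ_q > ⌊4k μ/12⌋`, `μ = [SL₂(ℤ) : Γ₀(N)]`, then `f = 0`: the decay-form Sturm bound of
the tree (`coe_eq_zero_of_lt_finsum`) for the weight-`4k` cusp form `f⁸`, whose translate at the
coset `g⁻¹Γ₀(N)` is `(f⁸)|g = (slashSq k f g)⁴`. [cite: Shimura1973HalfIntegral, §1] -/
theorem eq_zero_of_lt_finsum_slashSq [NeZero N] (hN : 4 ∣ N) (hχ : χ ^ 8 = 1) {f : ℍ → ℂ}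
    (hf : f ∈ halfIntCuspForms k N χ)
    (δ : 𝒮ℒ ⧸ (Gamma0 N : Subgroup (GL (Fin 2) ℝ)).subgroupOf 𝒮ℒ → ℝ)
    (hδ : ∀ q, ∃ g : SL(2, ℤ),
      ((Matrix.SpecialLinearGroup.mapGL ℝ).rangeRestrict g⁻¹ :
          𝒮ℒ ⧸ (Gamma0 N : Subgroup (GL (Fin 2) ℝ)).subgroupOf 𝒮ℒ) = q ∧
        slashSq k f g =O[atImInfty] fun τ ↦ Real.exp (-2 * π * δ q * τ.im))
    (h : (((((4 * k : ℕ) : ℤ) *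
        Nat.card (𝒮ℒ ⧸ (Gamma0 N : Subgroup (GL (Fin 2) ℝ)).subgroupOf 𝒮ℒ)).toNat / 12 : ℕ) : ℝ) <
      ∑ᶠ q, 4 * δ q) :
    f = 0 := by
  set P := powEightCuspForm hN hχ hf with hP
  have hzero : (⇑P) = 0 := by
    refine coe_eq_zero_of_lt_finsum P (fun q ↦ 4 * δ q) (fun q ↦ ?_) h
    obtain ⟨g, rfl, hdec⟩ := hδ q
    rw [quotientFunc_coe_rangeRestrict, inv_inv, coe_powEightCuspForm]
    exact pow_eight_slash_isBigO hdec
  exact eq_zero_of_pow_eight_eq_zero (by rw [← coe_powEightCuspForm hN hχ hf]; exact hzero)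

/-! ### The criterion with finitely many distinguished cusps -/

/-- **Vanishing criterion with distinguished cusps.** Let `f ∈ S_{k/2}(N, χ)` (`4 ∣ N`, `χ⁸ = 1`),
let `S ⊆ SL₂(ℤ)` be a finite set whose elements define pairwise distinct cosets `g⁻¹Γ₀(N)`
(i.e. pairwise `Γ₀(N)`-inequivalent "directions" `g`), and suppose
`slashSq k f g = O(e^{-2π s_g Im z})` for each `g ∈ S`. If
`⌊4k μ/12⌋ + #S < 4 ∑_{g ∈ S} s_g + ε_∞`, where `μ = [SL₂(ℤ) : Γ₀(N)]` and `ε_∞` is the number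
of cusps of `Γ₀(N)`, then `f = 0`. Proof: Sturm's decay bound for `f⁸ ∈ S_{4k}(Γ₀(N))` with the
rates `4 s_g` at the cosets `g⁻¹Γ₀(N)`, `g ∈ S`, and the free rate `1/w_q` (`w_q` = size of the
`T`-orbit of `q`, `quotientFunc_isBigO_of_smul_eq`) at every other coset `q`; since
`∑_q 1/w_q = #(T-orbits) ≥ ε_∞` and `1/w_q ≤ 1`, the total rate is at least
`4 ∑ s_g + ε_∞ - #S`. [cite: Shimura1973HalfIntegral, §1] -/
theorem eq_zero_of_decay_at_cusps [NeZero N] (hN : 4 ∣ N) (hχ : χ ^ 8 = 1) {f : ℍ → ℂ}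
    (hf : f ∈ halfIntCuspForms k N χ) (S : Finset SL(2, ℤ)) (s : SL(2, ℤ) → ℝ)
    (hS : (S : Set SL(2, ℤ)).InjOn fun g ↦
      ((Matrix.SpecialLinearGroup.mapGL ℝ).rangeRestrict g⁻¹ :
        𝒮ℒ ⧸ (Gamma0 N : Subgroup (GL (Fin 2) ℝ)).subgroupOf 𝒮ℒ))
    (hdec : ∀ g ∈ S, slashSq k f g =O[atImInfty] fun τ ↦ Real.exp (-2 * π * s g * τ.im))
    (h : (((((4 * k : ℕ) : ℤ) *
        Nat.card (𝒮ℒ ⧸ (Gamma0 N : Subgroup (GL (Fin 2) ℝ)).subgroupOf 𝒮ℒ)).toNat / 12 : ℕ) : ℝ) +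
        S.card < 4 * ∑ g ∈ S, s g + Nat.card (CuspOrbits (Gamma0 N : Subgroup (GL (Fin 2) ℝ)))) :
    f = 0 := by
  classical
  set 𝒢 : Subgroup (GL (Fin 2) ℝ) := (Gamma0 N : Subgroup (GL (Fin 2) ℝ)) with h𝒢
  let _ := Fintype.ofFinite (𝒮ℒ ⧸ 𝒢.subgroupOf 𝒮ℒ)
  set P := powEightCuspForm hN hχ hf with hP
  set mk : SL(2, ℤ) → 𝒮ℒ ⧸ 𝒢.subgroupOf 𝒮ℒ := fun g ↦
    ((Matrix.SpecialLinearGroup.mapGL ℝ).rangeRestrict g⁻¹ : 𝒮ℒ ⧸ 𝒢.subgroupOf 𝒮ℒ) with hmk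
  set T' : 𝒮ℒ := (Matrix.SpecialLinearGroup.mapGL ℝ).rangeRestrict ModularGroup.T with hT'
  let per : 𝒮ℒ ⧸ 𝒢.subgroupOf 𝒮ℒ → ℕ := fun q ↦ Function.minimalPeriod (T' • ·) q
  have hper : ∀ q, (per q : ℝ) = Nat.card (MulAction.orbit (Subgroup.zpowers T') q) := by
    intro q
    have := MulAction.minimalPeriod_eq_card T' q
    simp only [per, this, Fintype.card_eq_nat_card]
    rfl
  have hper_pos : ∀ q, 0 < per q := by
    intro q
    have : (0 : ℝ) < per q := by
      rw [hper, Nat.cast_pos, Nat.card_pos_iff]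
      exact ⟨⟨q, MulAction.mem_orbit_self q⟩, inferInstance⟩
    exact_mod_cast this
  -- the rate function
  let δ : 𝒮ℒ ⧸ 𝒢.subgroupOf 𝒮ℒ → ℝ := fun q ↦
    if hq : ∃ g ∈ S, mk g = q then 4 * s hq.choose else 1 / per q
  have hδS : ∀ g ∈ S, δ (mk g) = 4 * s g := by
    intro g hg
    have hex : ∃ g' ∈ S, mk g' = mk g := ⟨g, hg, rfl⟩
    simp only [δ, dif_pos hex]
    congr 1
    congr 1
    exact hS hex.choose_spec.1 hg hex.choose_spec.2
  have hδ : ∀ q, quotientFunc P q =O[atImInfty] fun τ ↦ Real.exp (-2 * π * δ q * τ.im) := by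
    intro q
    by_cases hq : ∃ g ∈ S, mk g = q
    · obtain ⟨g, hg, rfl⟩ := hq
      rw [hδS g hg]
      simp only [hmk]
      rw [quotientFunc_coe_rangeRestrict, inv_inv, coe_powEightCuspForm]
      exact pow_eight_slash_isBigO (hdec g hg)
    · simp only [δ, dif_neg hq]
      obtain ⟨g, rfl⟩ := exists_coe_rangeRestrict_eq q
      exact quotientFunc_isBigO_of_smul_eq P g (hper_pos _)
        (MulAction.pow_smul_eq_iff_minimalPeriod_dvd.mpr (dvd_refl _))
  have hzero : (⇑P) = 0 := by
    refine coe_eq_zero_of_lt_finsum P δ hδ ?_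
    -- lower bound for `∑ δ`
    have hsum : ∑ᶠ q, δ q = ∑ q, δ q := finsum_eq_sum_of_fintype δ
    set Tset : Finset (𝒮ℒ ⧸ 𝒢.subgroupOf 𝒮ℒ) := S.image mk with hTset
    have hsplit : ∑ q, δ q = ∑ q ∈ Tset, δ q + ∑ q ∈ Finset.univ \ Tset, δ q := by
      rw [← Finset.sum_union Finset.disjoint_sdiff, Finset.union_sdiff_of_subset
        (Finset.subset_univ _)]
    have hT : ∑ q ∈ Tset, δ q = 4 * ∑ g ∈ S, s g := by
      rw [hTset, Finset.sum_image (fun x hx y hy hxy ↦ hS hx hy hxy), Finset.mul_sum]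
      exact Finset.sum_congr rfl fun g hg ↦ hδS g hg
    have hrest : ∑ q ∈ Finset.univ \ Tset, δ q = ∑ q ∈ Finset.univ \ Tset, (1 : ℝ) / per q := by
      refine Finset.sum_congr rfl fun q hq ↦ ?_
      have hq' : ¬ ∃ g ∈ S, mk g = q := by
        rintro ⟨g, hg, rfl⟩
        exact (Finset.mem_sdiff.mp hq).2 (Finset.mem_image_of_mem mk hg)
      simp only [δ, dif_neg hq']
    have hrest_ge : ∑ q, (1 : ℝ) / per q - Tset.card ≤ ∑ q ∈ Finset.univ \ Tset, (1 : ℝ) / per q := by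
      have h1 : ∑ q, (1 : ℝ) / per q =
          ∑ q ∈ Tset, (1 : ℝ) / per q + ∑ q ∈ Finset.univ \ Tset, (1 : ℝ) / per q := by
        rw [← Finset.sum_union Finset.disjoint_sdiff, Finset.union_sdiff_of_subset
          (Finset.subset_univ _)]
      have h2 : ∑ q ∈ Tset, (1 : ℝ) / per q ≤ Tset.card := by
        have : ∀ q ∈ Tset, (1 : ℝ) / per q ≤ 1 := fun q _ ↦ by
          rw [div_le_one (by exact_mod_cast hper_pos q)]
          exact_mod_cast hper_pos q
        calc ∑ q ∈ Tset, (1 : ℝ) / per q ≤ ∑ q ∈ Tset, (1 : ℝ) := Finset.sum_le_sum this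
          _ = Tset.card := by simp
      linarith
    have hTcard : (Tset.card : ℝ) ≤ S.card := by exact_mod_cast Finset.card_image_le
    have horb : ∑ q, (1 : ℝ) / per q =
        Nat.card (MulAction.orbitRel.Quotient (Subgroup.zpowers T') (𝒮ℒ ⧸ 𝒢.subgroupOf 𝒮ℒ)) := by
      rw [← finsum_one_div_card_orbit, finsum_eq_sum_of_fintype]
      exact Finset.sum_congr rfl fun q _ ↦ by rw [hper]
    have hcusps := card_cuspOrbits_le_card_quotient_zpowers_T (𝒢 := 𝒢)
    rw [← hT'] at hcusps
    have hcusps' : (Nat.card (CuspOrbits 𝒢) : ℝ) ≤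
        Nat.card (MulAction.orbitRel.Quotient (Subgroup.zpowers T') (𝒮ℒ ⧸ 𝒢.subgroupOf 𝒮ℒ)) := by
      exact_mod_cast hcusps
    rw [hsum, hsplit, hT, hrest]
    linarith
  exact eq_zero_of_pow_eight_eq_zero (by rw [← coe_powEightCuspForm hN hχ hf]; exact hzero)

/-- **Numerical form for `Γ₀(N)`**: `[SL₂(ℤ) : Γ₀(N)] = μ(N) = N ∏_{p ∣ N}(1 + 1/p)` and
`ε_∞(Γ₀(N)) = ν_∞(N) = ∑_{d ∣ N} φ(gcd(d, N/d))` (the tree's `index_gamma0_eq_gamma0Index_holds`,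
`numCusps_eq_nuInfty_holds`), so the criterion reads
`⌊4k μ(N)/12⌋ + #S < 4 ∑ s_g + ν_∞(N)`. [cite: Shimura1973HalfIntegral, §1] -/
theorem eq_zero_of_decay_at_cusps' [NeZero N] (hN : 4 ∣ N) (hχ : χ ^ 8 = 1) {f : ℍ → ℂ}
    (hf : f ∈ halfIntCuspForms k N χ) (S : Finset SL(2, ℤ)) (s : SL(2, ℤ) → ℝ)
    (hS : (S : Set SL(2, ℤ)).InjOn fun g ↦
      ((Matrix.SpecialLinearGroup.mapGL ℝ).rangeRestrict g⁻¹ :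
        𝒮ℒ ⧸ (Gamma0 N : Subgroup (GL (Fin 2) ℝ)).subgroupOf 𝒮ℒ))
    (hdec : ∀ g ∈ S, slashSq k f g =O[atImInfty] fun τ ↦ Real.exp (-2 * π * s g * τ.im))
    (h : ((4 * k * gamma0Index N / 12 : ℕ) : ℝ) + S.card < 4 * ∑ g ∈ S, s g + nuInfty N) :
    f = 0 := by
  refine eq_zero_of_decay_at_cusps hN hχ hf S s hS hdec ?_
  have hc : Nat.card (CuspOrbits (Gamma0 N : Subgroup (GL (Fin 2) ℝ))) = nuInfty N :=
    numCusps_eq_nuInfty_holds N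
  rw [card_quotient_subgroupOf_eq_index, index_gamma0_eq_gamma0Index_holds N, hc]
  have e : ((((4 * k : ℕ) : ℤ) * ((gamma0Index N : ℕ) : ℤ)).toNat / 12 : ℕ) =
      4 * k * gamma0Index N / 12 := by
    rw [← Nat.cast_mul, Int.toNat_natCast]
  rw [e]
  exact h

end Literature.NumberTheory.EllipticCurves.ModularForms

end
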